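import Summits.Ventures.PercRepro.S1CFGCrude

/-!
# PercRepro — THE SHARP `3`-SET CAP AT NULLITY `3`: `Q₃² ≤ 3n − 8` FOR EVERY LOOPLESS COLOOP-FREE MATROID OF
NULLITY `3` ON `n ≥ 8` POINTS (p1, gen 41)

p7's contraction regimes with `k₀ = 3` price the contraction `N = M ／ V` (loopless, coloop-free, nullity `3` on
`R = n − w` points) through its low-rank set counts of size `≤ 3`: `D₂ = Q₂¹` (dependent pairs), `Q₃¹` (`3`-sets of
rank `≤ 1`) and `Q₃² = D₃` (`3`-sets of rank `≤ 2`). The landed crude chain gives `D₂ ≤ 3`, `Q₃¹ ≤ 1` (S1CFGCrude at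
`ν = 3`) and `Q₃² ≤ (n − 2)·D₂ + C(5, 3) = 3n + 4`; this module replaces the last by the EXACT cap
**`Q₃² ≤ 3n − 8`** (attained by `U_{1,3} ⊕ U_{n−4,n−3}`: the class of three with its `3·(n − 3) + 1` dependent
`3`-sets and the long circuit).

Proof. `Q₃² ≤ A + c₃` with `A` the `3`-sets containing a dependent pair and `c₃` the `3`-circuits
(`ncard_three_eRk_le_two_le_split`'s decomposition). With `≤ 1` dependent pair: `A ≤ n − 2`, `c₃ ≤ 10`, and
`n + 8 ≤ 3n − 8`. With `≥ 2` dependent pairs let `U` be the set of PARTNERED points (points with a parallel partner):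
every dependent pair lies in `U`, `U` is proper (`2·rk U ≤ |U|` while `2·rk E > n`), so its nullity is `≤ 2`; the `≥ 2`
relative circuits of size `2` force nullity `≥ 2`, hence `|U| = rk U + 2 ≤ 4`. Then
* **`not_isCircuit_three_of_two_le_dep_pairs`** — there is NO `3`-circuit `C`: `C ⊄ U` raises the nullity of `U ∪ C`
  (`≤ 7 < n` points) to `3`; `C ⊆ U` leaves `≤ 1` point of `U` outside `C` for the partners of two points of `C`,
  which then share a partner and form a dependent pair inside the circuit;
* **`ncard_with_dep_pair_three_le_of_subset`** — `A ≤ D₂·(n − |U|) + C(|U|, 3)` (a `3`-set with a dependent pair is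
  either inside `U` or the pair plus one point outside `U`: the injection `X ↦ (X ∩ U, X ∖ U)`);
* with `D₂ ≤ 3`, `D₂ ≤ C(|U|, 2)` and `|U| ≤ 4`: `|U| ∈ {3, 4}` and `3·(n − 3) + 1 = 3·(n − 4) + 4 = 3n − 8`.
**`ncard_three_eRk_le_two_le_of_nullity_three`** is the cap; `nullityThree_caps` collects the three counts of the
`k₀ = 3` regime and `nullityThree_*` the numerals at `n = 9, 10, 11, 12`. Nothing about any cell is claimed.
Axioms: standard.
-/

open scoped Matroid

namespace PercRepro

namespace S1CFG

open Set S1CF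

variable {α : Type}

/-- **No `3`-circuit with two dependent pairs** (loopless, coloop-free, nullity `3`, `n ≥ 8`): the partnered set
`U` has nullity exactly `2` and `≤ 4` points; a `3`-circuit outside `U` raises the nullity of `U ∪ C` (`≤ 7` points)
to `3`, a `3`-circuit inside `U` forces two of its points to share a parallel partner. -/
theorem not_isCircuit_three_of_two_le_dep_pairs (M : Matroid α) [M.Finite] (hL : ∀ e ∈ M.E, ¬ M.IsLoop e)
    (hK : ∀ e, ¬ M.IsColoop e) (hd : M.E.encard = M.eRank + ((3 : ℕ) : ℕ∞)) (hn : 8 ≤ M.E.ncard)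
    (h2 : 2 ≤ {P : Set α | P ⊆ M.E ∧ P.ncard = 2 ∧ M.Dep P}.ncard) {C : Set α} (hC : M.IsCircuit C)
    (hC3 : C.ncard = 3) : False := by
  classical
  have hEfin := M.ground_finite
  have hCE : C ⊆ M.E := hC.subset_ground
  -- the points with a partner
  set U := {u ∈ M.E | ∃ v ∈ M.E, v ≠ u ∧ M.Dep {u, v}} with hUdef
  have hUE : U ⊆ M.E := fun u hu => hu.1
  have hUfin : U.Finite := hEfin.subset hUE
  -- all dependent pairs are relative circuits of `U`
  have hpairs : {P : Set α | P ⊆ M.E ∧ P.ncard = 2 ∧ M.Dep P} ⊆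
      {P : Set α | P ⊆ U ∧ P.ncard = 2 ∧ M.Dep (∅ ∪ P) ∧ ∀ Q, Q ⊂ P → M.Indep (∅ ∪ Q)} := by
    intro P hP
    obtain ⟨hPE, hP2, hPdep⟩ := hP
    refine ⟨?_, hP2, by simpa using hPdep, fun Q hQ => by simpa using indep_of_ssubset_pair M hL hPE hP2 hQ⟩
    intro u huP
    refine ⟨hPE huP, ?_⟩
    obtain ⟨a, b, hab, rfl⟩ := Set.ncard_eq_two.1 hP2
    rcases huP with rfl | rfl
    · exact ⟨b, hPE (by simp), Ne.symm hab, hPdep⟩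
    · exact ⟨a, hPE (by simp), hab, by rwa [Set.pair_comm]⟩
  -- the nullity of `U` is `≥ 2` (two relative circuits of size `2` do not fit in nullity `1`)
  have hnull2 : (M.eRk U).toNat + 2 ≤ U.ncard := by
    by_contra hlt
    push Not at hlt
    have hν : (∅ ∪ U).ncard ≤ (M.eRk (∅ ∪ U)).toNat + 1 := by
      simpa using (by omega : U.ncard ≤ (M.eRk U).toNat + 1)
    have := (Set.ncard_le_ncard hpairs (relCircuits_finite M ∅ hUE 2)).trans
      (ncard_relCircuits_le M 2 (by norm_num) 1 ∅ U (empty_subset _) hUE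
        (Set.disjoint_left.2 fun a ha => absurd ha (Set.notMem_empty a)) M.empty_indep hν)
    norm_num at this
    omega
  -- `U` is covered by partners, so `U ≠ E` and `2 · rk U ≤ |U|`
  have hpartU : ∀ y ∈ U, ∃ z ∈ U, z ≠ y ∧ M.Dep {y, z} := by
    intro y hy
    obtain ⟨v, hvE, hvy, hdep⟩ := hy.2
    exact ⟨v, ⟨hvE, y, hy.1, Ne.symm hvy, by rwa [Set.pair_comm]⟩, hvy, hdep⟩
  have hcover := two_mul_eRk_toNat_le_ncard_of_partner M hL U.ncard U hUE rfl hpartU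
  have hrkE : M.E.ncard = (M.eRk M.E).toNat + 3 := ncard_ground_eq_eRk_toNat_add M hd
  have hUne : U ≠ M.E := by
    intro h
    rw [h] at hcover
    omega
  have hUnull := ncard_add_one_le_eRk_toNat_add_of_ssubset M hd hK hUE hUne
  have hU4 : U.ncard ≤ 4 := by omega
  by_cases hCU : C ⊆ U
  · -- the partners of two points of `C` lie in `U ∖ C`, a set of `≤ 1` point
    have hUC1 : (U \ C).ncard ≤ 1 := by
      rw [Set.ncard_sdiff' hCU hUfin]
      omega
    obtain ⟨x, y, z, hxy, hxz, hyz, hCxyz⟩ := Set.ncard_eq_three.1 hC3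
    have hxC : x ∈ C := by rw [hCxyz]; simp
    have hyC : y ∈ C := by rw [hCxyz]; simp
    obtain ⟨px, hpxE, hpxx, hdepx⟩ := (hCU hxC).2
    obtain ⟨py, hpyE, hpyy, hdepy⟩ := (hCU hyC).2
    have hpxU : px ∈ U := ⟨hpxE, x, hCE hxC, Ne.symm hpxx, by rwa [Set.pair_comm]⟩
    have hpyU : py ∈ U := ⟨hpyE, y, hCE hyC, Ne.symm hpyy, by rwa [Set.pair_comm]⟩
    have hpxC : px ∉ C := fun h =>
      not_dep_pair_of_isCircuit M hC (by
        intro w hw; rcases hw with rfl | rfl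
        · exact hxC
        · exact h) (Set.ncard_pair (Ne.symm hpxx)) (by omega) hdepx
    have hpyC : py ∉ C := fun h =>
      not_dep_pair_of_isCircuit M hC (by
        intro w hw; rcases hw with rfl | rfl
        · exact hyC
        · exact h) (Set.ncard_pair (Ne.symm hpyy)) (by omega) hdepy
    have heq : px = py := (Set.ncard_le_one_iff hUfin.sdiff).1 hUC1 ⟨hpxU, hpxC⟩ ⟨hpyU, hpyC⟩
    have hLp := hL px hpxE
    have h1 : x ∈ M.closure {px} := mem_closure_singleton_of_dep_pair M hpxE hLp (by rwa [Set.pair_comm])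
    have h2' : y ∈ M.closure {px} := by
      rw [heq]
      exact mem_closure_singleton_of_dep_pair M hpyE (hL py hpyE) (by rwa [Set.pair_comm])
    have hsub : ({x, y} : Set α) ⊆ M.closure {px} := by
      intro w hw; rcases hw with rfl | rfl
      · exact h1
      · exact h2'
    have hr : M.eRk {x, y} ≤ 1 := eRk_le_one_of_subset_closure_singleton M hsub
    have hdep2 : M.Dep {x, y} := by
      have hfin : ({x, y} : Set α).Finite := Set.toFinite _
      rw [← Matroid.eRk_lt_encard_iff_dep_of_finite hfin (by
        intro w hw; rcases hw with rfl | rfl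
        · exact hCE hxC
        · exact hCE hyC)]
      rw [Set.encard_pair hxy]
      exact lt_of_le_of_lt hr (by norm_num)
    exact not_dep_pair_of_isCircuit M hC (by
      intro w hw; rcases hw with rfl | rfl
      · exact hxC
      · exact hyC) (Set.ncard_pair hxy) (by omega) hdep2
  · -- `C ⊄ U`: the nullity of `U ∪ C` is `≥ 3` on `≤ 7 < n` points
    have hstep := S1.nullity_step M hUE hC hCU
    have hUCE : U ∪ C ⊆ M.E := union_subset hUE hCE
    have hUCcard : (U ∪ C).ncard ≤ U.ncard + C.ncard := Set.ncard_union_le U C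
    have hUCne : U ∪ C ≠ M.E := by
      intro h
      rw [h] at hUCcard
      omega
    have := ncard_add_one_le_eRk_toNat_add_of_ssubset M hd hK hUCE hUCne
    omega

/-- **The `3`-sets containing a dependent pair, counted through a set `U` containing every dependent pair**:
`A ≤ D₂ · |E ∖ U| + C(|U|, 3)` — such a `3`-set is inside `U`, or it is a dependent pair together with one point
outside `U` (the injection `X ↦ (X ∩ U, X ∖ U)`). -/
theorem ncard_with_dep_pair_three_le_of_subset (M : Matroid α) [M.Finite] {U : Set α} (hUE : U ⊆ M.E)
    (hpairs : ∀ P, P ⊆ M.E → P.ncard = 2 → M.Dep P → P ⊆ U) :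
    {X : Set α | X ⊆ M.E ∧ X.ncard = 3 ∧ ∃ P ⊆ X, P.ncard = 2 ∧ M.Dep P}.ncard ≤
      {P : Set α | P ⊆ M.E ∧ P.ncard = 2 ∧ M.Dep P}.ncard * (M.E \ U).ncard + U.ncard.choose 3 := by
  classical
  have hEfin := M.ground_finite
  have hUfin : U.Finite := hEfin.subset hUE
  set 𝒟 := {P : Set α | P ⊆ M.E ∧ P.ncard = 2 ∧ M.Dep P} with h𝒟
  set A₁ := {X : Set α | X ⊆ M.E ∧ X.ncard = 3 ∧ ¬ X ⊆ U ∧ ∃ P ⊆ X, P.ncard = 2 ∧ M.Dep P} with hA₁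
  set A₂ := {X : Set α | X ⊆ U ∧ X.ncard = 3} with hA₂
  have hA₁fin : A₁.Finite := hEfin.finite_subsets.subset (fun X hX => hX.1)
  have hA₂fin : A₂.Finite := hUfin.finite_subsets.subset (fun X hX => hX.1)
  have hsplit : {X : Set α | X ⊆ M.E ∧ X.ncard = 3 ∧ ∃ P ⊆ X, P.ncard = 2 ∧ M.Dep P} ⊆ A₁ ∪ A₂ := by
    intro X hX
    obtain ⟨hXE, hX3, hP⟩ := hX
    by_cases hXU : X ⊆ U
    · exact Or.inr ⟨hXU, hX3⟩
    · exact Or.inl ⟨hXE, hX3, hXU, hP⟩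
  have hA₂ : A₂.ncard = U.ncard.choose 3 := ncard_subsets_eq_choose hUfin 3
  have hA₁ : A₁.ncard ≤ 𝒟.ncard * (M.E \ U).ncard := by
    have h𝒟fin : 𝒟.Finite := hEfin.finite_subsets.subset (fun P hP => hP.1)
    have htfin : (𝒟 ×ˢ ((fun x : α => ({x} : Set α)) '' (M.E \ U))).Finite :=
      h𝒟fin.prod (hEfin.sdiff.image _)
    calc A₁.ncard ≤ (𝒟 ×ˢ ((fun x : α => ({x} : Set α)) '' (M.E \ U))).ncard := by
          refine Set.ncard_le_ncard_of_injOn (fun X => (X ∩ U, X \ U)) ?_ ?_ htfin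
          · intro X hX
            obtain ⟨hXE, hX3, hXU, P, hPX, hP2, hPdep⟩ := hX
            have hPE : P ⊆ M.E := hPX.trans hXE
            have hPU : P ⊆ U := hpairs P hPE hP2 hPdep
            have hXfin : X.Finite := hEfin.subset hXE
            obtain ⟨x, hxX, hxU⟩ : ∃ x ∈ X, x ∉ U := by
              by_contra h
              push Not at h
              exact hXU h
            have hxP : x ∉ P := fun h => hxU (hPU h)
            have hXeq : X = insert x P := by
              symm
              refine Set.eq_of_subset_of_ncard_le (Set.insert_subset hxX hPX) ?_ hXfin
              have := Set.ncard_insert_of_notMem hxP (hEfin.subset hPE)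
              omega
            have hXU' : X ∩ U = P := by
              rw [hXeq, Set.insert_inter_of_notMem hxU]
              exact Set.inter_eq_self_of_subset_left hPU
            have hXd : X \ U = {x} := by
              rw [hXeq]
              ext w
              simp only [Set.mem_sdiff, Set.mem_insert_iff, Set.mem_singleton_iff]
              constructor
              · rintro ⟨hw | hw, hwU⟩
                · exact hw
                · exact absurd (hPU hw) hwU
              · rintro rfl
                exact ⟨Or.inl rfl, hxU⟩
            refine Set.mem_prod.2 ⟨?_, ?_⟩
            · rw [hXU']
              exact ⟨hPE, hP2, hPdep⟩
            · rw [hXd]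
              exact ⟨x, ⟨hXE hxX, hxU⟩, rfl⟩
          · intro X _ Y _ hXY
            simp only [Prod.mk.injEq] at hXY
            rw [← Set.inter_union_sdiff X U, ← Set.inter_union_sdiff Y U, hXY.1, hXY.2]
      _ = 𝒟.ncard * (M.E \ U).ncard := by
          rw [Set.ncard_prod, Set.ncard_image_of_injective _ Set.singleton_injective]
  calc {X : Set α | X ⊆ M.E ∧ X.ncard = 3 ∧ ∃ P ⊆ X, P.ncard = 2 ∧ M.Dep P}.ncard
      ≤ (A₁ ∪ A₂).ncard := Set.ncard_le_ncard hsplit (hA₁fin.union hA₂fin)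
    _ ≤ A₁.ncard + A₂.ncard := Set.ncard_union_le _ _
    _ ≤ _ := by rw [hA₂]; exact Nat.add_le_add_right hA₁ _

/-- **THE SHARP `3`-SET CAP AT NULLITY `3`: `Q₃² ≤ 3n − 8`** for every loopless coloop-free matroid of nullity `3`
on `n ≥ 8` points (exact for `U_{1,3} ⊕ U_{n−4,n−3}`). -/
theorem ncard_three_eRk_le_two_le_of_nullity_three (M : Matroid α) [M.Finite] (hL : ∀ e ∈ M.E, ¬ M.IsLoop e)
    (hK : ∀ e, ¬ M.IsColoop e) (hd : M.E.encard = M.eRank + ((3 : ℕ) : ℕ∞)) (hn : 8 ≤ M.E.ncard) :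
    {X : Set α | X ⊆ M.E ∧ X.ncard = 3 ∧ M.eRk X ≤ 2}.ncard ≤ 3 * M.E.ncard - 8 := by
  classical
  have hEfin := M.ground_finite
  set 𝒟 := {P : Set α | P ⊆ M.E ∧ P.ncard = 2 ∧ M.Dep P} with h𝒟
  set A := {X : Set α | X ⊆ M.E ∧ X.ncard = 3 ∧ ∃ P ⊆ X, P.ncard = 2 ∧ M.Dep P} with hA
  set T := {C : Set α | C ⊆ M.E ∧ M.IsCircuit C ∧ C.ncard = 3} with hT
  have hAfin : A.Finite := hEfin.finite_subsets.subset (fun X hX => hX.1)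
  have hTfin : T.Finite := hEfin.finite_subsets.subset (fun X hX => hX.1)
  have hsplit : {X : Set α | X ⊆ M.E ∧ X.ncard = 3 ∧ M.eRk X ≤ 2} ⊆ A ∪ T := by
    intro X hX
    obtain ⟨hXE, hX3, hXr⟩ := hX
    have hXfin : X.Finite := hEfin.subset hXE
    have hXdep : M.Dep X := by
      rw [← Matroid.eRk_lt_encard_iff_dep_of_finite hXfin hXE, ← hXfin.cast_ncard_eq, hX3]
      exact lt_of_le_of_lt hXr (by norm_num)
    by_cases h : ∃ P ⊆ X, P.ncard = 2 ∧ M.Dep P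
    · exact Or.inl ⟨hXE, hX3, h⟩
    · push Not at h
      exact Or.inr ⟨hXE, isCircuit_of_dep_three_of_no_dep_pair M hXE hX3 hXdep h, hX3⟩
  have hQ : {X : Set α | X ⊆ M.E ∧ X.ncard = 3 ∧ M.eRk X ≤ 2}.ncard ≤ A.ncard + T.ncard :=
    (Set.ncard_le_ncard hsplit (hAfin.union hTfin)).trans (Set.ncard_union_le _ _)
  have hD3 : 𝒟.ncard ≤ 3 := by
    have h32 : (3 : ℕ).choose 2 = 3 := by decide
    have := ncard_dep_pairs_le_choose M hL hK hd (by omega : 2 * 3 + 1 ≤ M.E.ncard)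
    rw [h32] at this
    exact this
  have hAcrude : A.ncard ≤ (M.E.ncard - 2) * 𝒟.ncard := by
    have := ncard_with_dep_pair_le M 3
    rw [show (3 : ℕ) - 2 = 1 by norm_num, Nat.choose_one_right] at this
    exact this
  have hT10 : T.ncard ≤ 10 := by
    have h10 : (3 + 3 - 1).choose 3 = 10 := by decide
    have hc := ncard_isCircuit_ncard_eq_le M (ν := 3) (k := 3) (by norm_num) (subset_refl M.E)
      (ncard_ground_eq_eRk_toNat_add M hd).le
    rw [h10] at hc
    exact hc
  by_cases hD1 : 𝒟.ncard ≤ 1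
  · have hAle : (M.E.ncard - 2) * 𝒟.ncard ≤ M.E.ncard - 2 := by
      calc (M.E.ncard - 2) * 𝒟.ncard ≤ (M.E.ncard - 2) * 1 := Nat.mul_le_mul_left _ hD1
        _ = M.E.ncard - 2 := mul_one _
    omega
  · push Not at hD1
    have hT0 : T.ncard = 0 := by
      rw [Set.ncard_eq_zero hTfin, Set.eq_empty_iff_forall_notMem]
      rintro C ⟨_, hC, hC3⟩
      exact not_isCircuit_three_of_two_le_dep_pairs M hL hK hd hn (show 2 ≤ 𝒟.ncard from hD1) hC hC3
    -- the points with a partner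
    set U := {u ∈ M.E | ∃ v ∈ M.E, v ≠ u ∧ M.Dep {u, v}} with hUdef
    have hUE : U ⊆ M.E := fun u hu => hu.1
    have hUfin : U.Finite := hEfin.subset hUE
    have hpairsU : ∀ P, P ⊆ M.E → P.ncard = 2 → M.Dep P → P ⊆ U := by
      intro P hPE hP2 hPdep u huP
      refine ⟨hPE huP, ?_⟩
      obtain ⟨a, b, hab, rfl⟩ := Set.ncard_eq_two.1 hP2
      rcases huP with rfl | rfl
      · exact ⟨b, hPE (by simp), Ne.symm hab, hPdep⟩
      · exact ⟨a, hPE (by simp), hab, by rwa [Set.pair_comm]⟩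
    have hpartU : ∀ y ∈ U, ∃ z ∈ U, z ≠ y ∧ M.Dep {y, z} := by
      intro y hy
      obtain ⟨v, hvE, hvy, hdep⟩ := hy.2
      exact ⟨v, ⟨hvE, y, hy.1, Ne.symm hvy, by rwa [Set.pair_comm]⟩, hvy, hdep⟩
    have hcover := two_mul_eRk_toNat_le_ncard_of_partner M hL U.ncard U hUE rfl hpartU
    have hrkE : M.E.ncard = (M.eRk M.E).toNat + 3 := ncard_ground_eq_eRk_toNat_add M hd
    have hUne : U ≠ M.E := by
      intro h
      rw [h] at hcover
      omega
    have hUnull := ncard_add_one_le_eRk_toNat_add_of_ssubset M hd hK hUE hUne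
    have hU4 : U.ncard ≤ 4 := by omega
    -- the dependent pairs are `2`-subsets of `U`
    have hDU : 𝒟.ncard ≤ U.ncard.choose 2 := by
      rw [← ncard_subsets_eq_choose hUfin 2]
      refine Set.ncard_le_ncard ?_ (hUfin.finite_subsets.subset (fun P hP => hP.1))
      intro P hP
      exact ⟨hpairsU P hP.1 hP.2.1 hP.2.2, hP.2.1⟩
    have hAU : A.ncard ≤ 𝒟.ncard * (M.E \ U).ncard + U.ncard.choose 3 :=
      ncard_with_dep_pair_three_le_of_subset M hUE hpairsU
    rw [Set.ncard_sdiff' hUE hEfin] at hAU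
    have hUEle : U.ncard ≤ M.E.ncard := Set.ncard_le_ncard hUE hEfin
    obtain ⟨u, hu⟩ : ∃ u, U.ncard = u := ⟨_, rfl⟩
    rw [hu] at hDU hAU hU4 hUEle
    have hmul : 𝒟.ncard * (M.E.ncard - u) ≤ 3 * (M.E.ncard - u) := Nat.mul_le_mul_right _ hD3
    generalize hm : 𝒟.ncard * (M.E.ncard - u) = m at hmul hAU
    interval_cases u
    · have h0 : (0 : ℕ).choose 2 = 0 := by decide
      omega
    · have h1 : (1 : ℕ).choose 2 = 0 := by decide
      omega
    · have h1 : (2 : ℕ).choose 2 = 1 := by decide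
      omega
    · have h33 : (3 : ℕ).choose 3 = 1 := by decide
      omega
    · have h43 : (4 : ℕ).choose 3 = 4 := by decide
      omega

/-- **The three counts of the `k₀ = 3` regime** (loopless, coloop-free, nullity `3`, `n ≥ 8`): `D₂ ≤ 3`, `Q₃¹ ≤ 1`,
`Q₃² ≤ 3n − 8`. -/
theorem nullityThree_caps (M : Matroid α) [M.Finite] (hL : ∀ e ∈ M.E, ¬ M.IsLoop e)
    (hK : ∀ e, ¬ M.IsColoop e) (hd : M.E.encard = M.eRank + ((3 : ℕ) : ℕ∞)) (hn : 8 ≤ M.E.ncard) :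
    {X : Set α | X ⊆ M.E ∧ X.ncard = 2 ∧ M.eRk X ≤ 1}.ncard ≤ 3 ∧
      {X : Set α | X ⊆ M.E ∧ X.ncard = 3 ∧ M.eRk X ≤ 1}.ncard ≤ 1 ∧
      {X : Set α | X ⊆ M.E ∧ X.ncard = 3 ∧ M.eRk X ≤ 2}.ncard ≤ 3 * M.E.ncard - 8 := by
  have hEfin := M.ground_finite
  have hD3 : {P : Set α | P ⊆ M.E ∧ P.ncard = 2 ∧ M.Dep P}.ncard ≤ 3 := by
    have h32 : (3 : ℕ).choose 2 = 3 := by decide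
    have := ncard_dep_pairs_le_choose M hL hK hd (by omega : 2 * 3 + 1 ≤ M.E.ncard)
    rw [h32] at this
    exact this
  have hQ21 : {X : Set α | X ⊆ M.E ∧ X.ncard = 2 ∧ M.eRk X ≤ 1}.ncard ≤ 3 :=
    (Set.ncard_le_ncard (two_eRk_le_one_subset_dep M)
      (hEfin.finite_subsets.subset (fun P hP => hP.1))).trans hD3
  refine ⟨hQ21, ?_, ncard_three_eRk_le_two_le_of_nullity_three M hL hK hd hn⟩
  have hrkE : M.E.ncard = (M.eRk M.E).toNat + 3 := ncard_ground_eq_eRk_toNat_add M hd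
  have h31 := three_mul_ncard_three_eRk_le_one_le M hL hK hd (by omega)
  rw [show (3 : ℕ) - 2 = 1 by norm_num, one_mul] at h31
  omega

/-- `Q₃² ≤ 19` at nullity `3` on `9` points. -/
theorem nullityThree_nine (M : Matroid α) [M.Finite] (hL : ∀ e ∈ M.E, ¬ M.IsLoop e)
    (hK : ∀ e, ¬ M.IsColoop e) (hd : M.E.encard = M.eRank + ((3 : ℕ) : ℕ∞)) (hn : M.E.ncard = 9) :
    {X : Set α | X ⊆ M.E ∧ X.ncard = 3 ∧ M.eRk X ≤ 2}.ncard ≤ 19 := by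
  have := ncard_three_eRk_le_two_le_of_nullity_three M hL hK hd (by omega)
  omega

/-- `Q₃² ≤ 22` at nullity `3` on `10` points. -/
theorem nullityThree_ten (M : Matroid α) [M.Finite] (hL : ∀ e ∈ M.E, ¬ M.IsLoop e)
    (hK : ∀ e, ¬ M.IsColoop e) (hd : M.E.encard = M.eRank + ((3 : ℕ) : ℕ∞)) (hn : M.E.ncard = 10) :
    {X : Set α | X ⊆ M.E ∧ X.ncard = 3 ∧ M.eRk X ≤ 2}.ncard ≤ 22 := by
  have := ncard_three_eRk_le_two_le_of_nullity_three M hL hK hd (by omega)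
  omega

/-- `Q₃² ≤ 25` at nullity `3` on `11` points. -/
theorem nullityThree_eleven (M : Matroid α) [M.Finite] (hL : ∀ e ∈ M.E, ¬ M.IsLoop e)
    (hK : ∀ e, ¬ M.IsColoop e) (hd : M.E.encard = M.eRank + ((3 : ℕ) : ℕ∞)) (hn : M.E.ncard = 11) :
    {X : Set α | X ⊆ M.E ∧ X.ncard = 3 ∧ M.eRk X ≤ 2}.ncard ≤ 25 := by
  have := ncard_three_eRk_le_two_le_of_nullity_three M hL hK hd (by omega)
  omega

/-- `Q₃² ≤ 28` at nullity `3` on `12` points. -/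
theorem nullityThree_twelve (M : Matroid α) [M.Finite] (hL : ∀ e ∈ M.E, ¬ M.IsLoop e)
    (hK : ∀ e, ¬ M.IsColoop e) (hd : M.E.encard = M.eRank + ((3 : ℕ) : ℕ∞)) (hn : M.E.ncard = 12) :
    {X : Set α | X ⊆ M.E ∧ X.ncard = 3 ∧ M.eRk X ≤ 2}.ncard ≤ 28 := by
  have := ncard_three_eRk_le_two_le_of_nullity_three M hL hK hd (by omega)
  omega

end S1CFG

end PercRepro
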